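import Literature.Probability.Process.SmallSets
import Summits.QuantumFields.YangMills.Theorems.ColdStartUniversalityLatticeLangevinFeller
import HarnessLib

/-!
# Route `ColdStartUniversality` (rung input (D), crux K_A1 stmt-QuantumFields-24809): Doeblin from a LOCAL small set

Helper file (seat `ym-line-csu-p1`, g4).  The rung `stub_fixedCutoffMixing` has been reduced in this tree to (D) a
uniform Doeblin minorisation `∃ t₀ ν ≠ 0, ∀ z, ν ≤ κ t₀ z` of the SZZ transition kernels plus the named fact
`WilsonMeasureLangevinInvariant` (`fixedCutoffMixing_of_harris`, `…_of_doeblin`).  Here (D) is reduced further, by the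
tree's small-set theory (`Literature.Probability.Process.SmallSets`, Cuneo–Eckmann–Hairer–Rey-Bellet Prop. 3.6) and
the Feller property landed for these kernels (`continuous_integral_transitionKernel`), to the two textbook inputs

* (D_loc) a LOCAL minorisation `ν₀ ≤ κ t (w, ·)` for `w` in an open set `G₀ ∋ x₀` and `t` in a window, with `ν₀`
  charging every neighbourhood of some point — the output of a transition-density lower bound near ONE point;
* (Irr) pointed irreducibility: every configuration reaches every neighbourhood of `x₀` with positive probability —
  the output of the Stroock–Varadhan support theorem + controllability of the (elliptic) link diffusion,

given Chapman–Kolmogorov for `κ` (proved in this tree for the SZZ kernels, `chapmanKolmogorov_szz`).  Compactness of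
`SU(2)^E` makes the whole space the small set.  No definition, no sorry.  RECORD-rung R3 plumbing; nothing here bears
on the mass gap.
-/

set_option autoImplicit false

noncomputable section

namespace Summit.QuantumFields.YangMills.Theorems.ColdStartUniversality

open MeasureTheory ProbabilityTheory Filter Topology
open scoped NNReal ENNReal BigOperators
open Literature.Probability.Process Literature.MathematicalPhysics.QuantumFieldTheory
open Literature.MathematicalPhysics.QuantumLattice (fundamentalRep fundamentalLatticeRep)

/-- The configuration space `SU(2)^E` admits outer approximations of closed sets by continuous functions (it is
metrisable). [folklore] -/
theorem hasOuterApproxClosed_config (L : ℕ) [NeZero L] :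
    HasOuterApproxClosed (GaugeConfig 3 L (Matrix.specialUnitaryGroup (Fin 2) ℂ)) := by
  haveI := polishSpace_config L
  letI := TopologicalSpace.upgradeIsCompletelyMetrizable (GaugeConfig 3 L (Matrix.specialUnitaryGroup (Fin 2) ℂ))
  infer_instance

/-- **Doeblin from a local small set** for a kernel family realising the SZZ transition laws: Chapman–Kolmogorov,
pointed irreducibility towards `x₀`, and a local minorisation near `x₀` by a measure charging every neighbourhood of
some point give a uniform minorisation `ν ≤ κ t₁ (z, ·)` for ALL `z ∈ SU(2)^E` (compact state space; Feller property
from `continuous_integral_transitionKernel`). [cite: CuneoEckmannHairerReyBellet2018, Prop 3.6] -/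
theorem doeblin_of_localSmall (L : ℕ) [NeZero L] (β' : ℝ)
    (κ : ℝ≥0 → Kernel (GaugeConfig 3 L (Matrix.specialUnitaryGroup (Fin 2) ℂ))
      (GaugeConfig 3 L (Matrix.specialUnitaryGroup (Fin 2) ℂ))) [∀ t, IsMarkovKernel (κ t)]
    (hreal : ∀ (t : ℝ≥0) (x : GaugeConfig 3 L (Matrix.specialUnitaryGroup (Fin 2) ℂ))
        (Ω : Type) [MeasurableSpace Ω] (P : Measure Ω) [IsProbabilityMeasure P]
        (W : ℝ≥0 → Ω → (Edge 3 L × NoiseIdx 2 → ℝ)) (hW : IsFlatBrownian W P)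
        (U : ℝ≥0 → Ω → GaugeConfig 3 L (Matrix.specialUnitaryGroup (Fin 2) ℂ)),
        (∀ ω, U 0 ω = x) →
        (latticeLangevinDynamics (fundamentalLatticeRep 2) β').IsSolution (fundamentalRep (Fin 2))
          hW.natFiltration P W U →
        κ t x = P.map (U t))
    (hCK : ∀ s t : ℝ≥0, κ (s + t) = κ t ∘ₖ κ s)
    {x₀ : GaugeConfig 3 L (Matrix.specialUnitaryGroup (Fin 2) ℂ)}
    (h_irred : ∀ (z : GaugeConfig 3 L (Matrix.specialUnitaryGroup (Fin 2) ℂ))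
      (V : Set (GaugeConfig 3 L (Matrix.specialUnitaryGroup (Fin 2) ℂ))), IsOpen V → x₀ ∈ V → ∃ t : ℝ≥0, 0 < κ t z V)
    {G₀ : Set (GaugeConfig 3 L (Matrix.specialUnitaryGroup (Fin 2) ℂ))} (hG₀ : IsOpen G₀) (hx₀ : x₀ ∈ G₀)
    {ν₀ : Measure (GaugeConfig 3 L (Matrix.specialUnitaryGroup (Fin 2) ℂ))}
    {y₀ : GaugeConfig 3 L (Matrix.specialUnitaryGroup (Fin 2) ℂ)}
    (hy₀ : ∀ V : Set (GaugeConfig 3 L (Matrix.specialUnitaryGroup (Fin 2) ℂ)), IsOpen V → y₀ ∈ V → 0 < ν₀ V)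
    {t₀ δ : ℝ} (hδ : 0 < δ) (hδt : δ ≤ t₀)
    (h_loc : ∀ t : ℝ≥0, t₀ - δ ≤ (t : ℝ) → (t : ℝ) ≤ t₀ + δ → ∀ w ∈ G₀, ν₀ ≤ κ t w) :
    ∃ (t₁ : ℝ≥0) (ν : Measure (GaugeConfig 3 L (Matrix.specialUnitaryGroup (Fin 2) ℂ))),
      ν ≠ 0 ∧ ∀ z, ν ≤ κ t₁ z := by
  haveI := secondCountableTopology_su2
  haveI := borelSpace_config L
  haveI := hasOuterApproxClosed_config L
  have h_feller : ∀ (t : ℝ≥0)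
      (g : BoundedContinuousFunction (GaugeConfig 3 L (Matrix.specialUnitaryGroup (Fin 2) ℂ)) ℝ),
      Continuous fun x => ∫ y, g y ∂(κ t x) :=
    fun t g => continuous_integral_transitionKernel L β' κ hreal t g.continuous
  obtain ⟨tC, htC⟩ := MarkovSemigroup.exists_smul_le_of_isCompact_of_mem κ hCK h_feller h_irred hG₀ hx₀ hy₀
    hδ hδt h_loc isCompact_univ
  obtain ⟨ε, hε0, -, hε⟩ := htC tC le_rfl
  refine ⟨tC, ε • ν₀, fun h => ?_, fun z => hε z (Set.mem_univ z)⟩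
  have h1 : (ε • ν₀) Set.univ = 0 := by rw [h]; rfl
  rw [Measure.smul_apply, smul_eq_mul] at h1
  rcases mul_eq_zero.1 h1 with h3 | h3
  · exact hε0.ne' h3
  · exact (hy₀ _ isOpen_univ (Set.mem_univ _)).ne' h3

end Summit.QuantumFields.YangMills.Theorems.ColdStartUniversality

end
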